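import Literature.Analysis.FluidPDE.NSLerayBlowupRateLpProofs
import Literature.Analysis.FluidPDE.KNSSTypeIIHolds
import HarnessLib

/-!
# Discharge of Leray's `Lʳ` blow-up rates `leray_blowup_rate` (**ns.S28**; Leray 1934, §22)

`Literature.Analysis.FluidPDE.leray_blowup_rate` (`NSLerayHopf.lean`) is the named fact: for
every `3 < r < ∞` there is `c_r > 0` such that every maximal smooth solution `(u, p)` of the
unforced Navier–Stokes system on `ℝ³ × [0, T)` (`IsMaximalSmoothSolution`: classical on `[0, T)`,
no classical continuation past `T`) which is a Leray–Hopf solution from `u(0)` and essentially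
bounded on every closed sub-strip `[0, T'] × ℝ³`, `T' < T`, satisfies
`‖u(t)‖_{Lʳ} ≥ c_r ν^{(r+3)/(2r)} (T - t)^{-(r-3)/(2r)}` for every `t ∈ [0, T)` (Leray 1934, Acta
Math. 63, §22, p. 227; Ożański–Pooley 2018, Cor. 6.25; Giga 1986, Thm. 4 (4.8);
Robinson–Rodrigo–Sadowski 2016, (11.18)). This file proves it **unconditionally**
(`leray_blowup_rate_holds`).

## The printed proof and the line taken here

Ożański–Pooley 2018, §6.3.3 (pp. 143–146) derive the `Lᵖ` rate (Cor. 6.25) from two facts about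
the strong solution `u` on its maximal interval `[0, T₀)`: **Lemma 6.23 (iii)** — the sup-norm
a-priori estimate `‖u(t)‖_∞ ≤ C‖u(t₁)‖_p (t - t₁)^{-3/2p}` on the `Lᵖ` window
`t - t₁ ≤ (C(1-3/p)/‖u(t₁)‖_p)^{2p/(p-3)}` (Leray 1934, §21, (3.5) with (3.14)–(3.15)) — and
**Cor. 6.24** — "`‖u(t)‖_∞` must blow up at `T₀`, as otherwise we could extend `u` beyond `T₀`"
(p. 143), i.e. *a strong solution which stays bounded up to `T₀` can be continued past `T₀`*
(Leray 1934, §21, (3.16): `t₀ + τ ≤ T`). The tree's first decomposition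
(`leray_blowup_rate_of_top_of_supnorm`, `NSLerayBlowupRateLp.lean`) feeds the second ingredient in
through the `L^∞` rate `leray_blowup_rate_top`, itself reduced to Leray's `L^∞` local existence
theorem (`leray_strong_local_existence`, not yet discharged). Here the continuation step is taken
instead, literally as printed ("otherwise we could extend `u`"), from the **continuation theorem for
bounded classical Leray–Hopf solutions** `hasSmoothExtensionPast_of_bounded` (`KNSSTypeII.lean`;
Robinson–Rodrigo–Sadowski 2016, Thm. 8.17 in the Serrin class `L²(0,T; L^∞)` with Thms. 6.15,
6.10 and the proof of Thm. 12.3, p. 170), which the tree PROVES from its local `H¹` theory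
(`hasSmoothExtensionPast_of_bounded_holds`, `KNSSTypeIIHolds.lean`, through
`hasSmoothExtensionPast_of_bounded_of_leray_regular` and the discharged
`leray_local_regular_H1_holds`; equivalently `hasSmoothExtensionPast_of_bounded_of_local_H1_theory`
with `leray_local_strong_H1_holds`, `tao2011_H1_local_almost_regular_holds`). Both ingredients
being proved, the rate follows with no named fact left in its trust base:

* `leray_blowup_rate_holds` — **the discharge of ns.S28 (`Lʳ` rates)**, with the constant
  `c_r = c^{(r-3)/(2r)}`, `c` the window constant of `leray_supnorm_le_of_Lp_holds` (`K = 2`).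

### The proof of `leray_blowup_rate_holds`

Let `(u, p)` be maximal smooth with lifespan `T`, Leray–Hopf from `u(0)`, essentially bounded on
closed sub-strips, `t₀ ∈ [0, T)`, and suppose
`‖u(t₀)‖_r < c^{(r-3)/(2r)} ν^{(r+3)/(2r)} (T - t₀)^{-(r-3)/(2r)} = (c ν^{(r+3)/(r-3)}/(T - t₀))^{(r-3)/(2r)}`.
Pick a real `N` strictly between the two sides; then `T - t₀ < τ := c ν^{(r+3)/(r-3)} N^{-2r/(r-3)}`:
the `Lʳ` window from `t₀` reaches beyond `T`. For every `s ∈ [(T + t₀)/2, T)` the translate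
`u(· + t₀)` is classical on `[0, t')`, `t' = (s - t₀ + T - t₀)/2`, Leray–Hopf from `u(t₀)` on
`[0, t']` (restart at the prescribed time `t₀`, `IsLerayHopfOn.isLerayHopfOn_translate_of_bound` —
every time is a restarting time in Serrin's class `L^∞L^∞`; nothing to do for `t₀ = 0`) and
pointwise bounded there (`exists_bound_Icc_of_eLpNorm_top`), so the sup-norm estimate
(`leray_supnorm_le_of_Lp_holds`) gives `‖u(s)‖_∞ ≤ K N (ν(s - t₀))^{-3/(2r)} ≤
B := K N (ν(T - t₀)/2)^{-3/(2r)}`, pointwise in `x` because `u(s)` is continuous. On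
`[0, (T + t₀)/2]` the solution is pointwise bounded as well (`exists_bound_Icc_of_eLpNorm_top`).
Hence `u` is bounded on `[0, T) × ℝ³`, and `hasSmoothExtensionPast_of_bounded_holds` continues it
classically past `T` — contradicting maximality. Hence
`‖u(t₀)‖_r ≥ c^{(r-3)/(2r)} ν^{(r+3)/(2r)} (T - t₀)^{-(r-3)/(2r)}`.

This is Ożański–Pooley's proof of Cor. 6.25 via Cor. 6.24 (iii) with the continuation argument
of p. 143 made explicit; compared with Leray's own §§19–22 it replaces the `L^∞` existence
theorem of §19 (lifespan (3.8)) by the `H¹` theory of §20 / RRS Thm. 6.15 inside the continuation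
step, which is how Robinson–Rodrigo–Sadowski (proof of Thm. 12.3) continue bounded solutions.

## Mathlib / tree search

Tree (`lean search 'leray_supnorm_le_of_Lp_holds|hasSmoothExtensionPast_of_bounded_holds|
leray_local_regular_H1_holds'`): all inputs above;
`exists_bound_Icc_of_eLpNorm_top` (`NSLerayHopfSereginProofs.lean`),
`eLpNorm_uncurry_restrict_lt_top_of_bound` (`NSLerayBlowupRateLp.lean`),
`forall_norm_le_of_ae_norm_le` (`NSLerayBlowupRateLpProofs.lean`),
`IsClassicalNSSolutionOn.translate_Ico_zero` (`ClassicalSolutionGlue.lean`). No statement or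
definition is introduced here. Mathlib: `ae_le_eLpNormEssSup`, `Real.rpow_*` algebra.

## References

* J. Leray, *Sur le mouvement d'un liquide visqueux emplissant l'espace*, Acta Math. 63 (1934),
  193–248: §21 (3.5), (3.14)–(3.16) (pp. 225–227), §22 (pp. 227–228). [Leray1934]
* W. S. Ożański, B. C. Pooley, *Leray's fundamental work on the Navier–Stokes equations: a modern
  review of "Sur le mouvement d'un liquide visqueux emplissant l'espace"*, in: Partial
  Differential Equations in Fluid Mechanics, LMS Lecture Note Ser. 452, CUP 2018, pp. 113–203
  (arXiv:1708.09787): §6.3.3, Lemma 6.23 (iii), Cor. 6.24 (iii) and p. 143, Cor. 6.25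
  (pp. 143–146). [OzanskiPooley2018]
* J. C. Robinson, J. L. Rodrigo, W. Sadowski, *The three-dimensional Navier–Stokes equations*,
  CUP 2016: Thm. 8.17, Thms. 6.10, 6.15, proof of Thm. 12.3 (p. 170); Notes to Ch. 11, (11.18).
  [RobinsonRodrigoSadowski2016]
* Y. Giga, J. Differential Equations 62 (1986), 186–212, Thm. 4, (4.8). [Giga1986]
-/

noncomputable section

open MeasureTheory TopologicalSpace Set Function Filter
open _root_.Topology
open scoped InnerProductSpace RealInnerProductSpace ENNReal NNReal

namespace Literature.Analysis.FluidPDE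

/-! ### A small tool -/

/-- **An `L^∞` bound on a continuous field on `ℝ³` holds pointwise**: if `f` is continuous,
`0 ≤ b` and `‖f‖_{L^∞} ≤ b` then `‖f x‖ ≤ b` for every `x` (the essential bound holds a.e.,
`ae_le_eLpNormEssSup`, and an a.e. bound on a continuous field holds everywhere because Lebesgue
measure charges nonempty open sets, `forall_norm_le_of_ae_norm_le`). [folklore] -/
theorem forall_norm_le_of_eLpNorm_top_le
    {f : EuclideanSpace ℝ (Fin 3) → EuclideanSpace ℝ (Fin 3)} (hf : Continuous f) {b : ℝ}
    (hb : 0 ≤ b) (h : eLpNorm f ∞ volume ≤ ENNReal.ofReal b) (x : EuclideanSpace ℝ (Fin 3)) :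
    ‖f x‖ ≤ b := by
  refine forall_norm_le_of_ae_norm_le hf ?_ x
  have hh := ae_le_eLpNormEssSup (f := f) (μ := (volume : Measure (EuclideanSpace ℝ (Fin 3))))
  rw [eLpNorm_exponent_top] at h
  filter_upwards [hh] with y hy
  have h1 := hy.trans h
  rwa [← ofReal_norm, ENNReal.ofReal_le_ofReal_iff hb] at h1

/-! ### The discharge of `leray_blowup_rate` -/

/-- **Discharge of ns.S28, `Lʳ` rates: Leray's lower bounds on the `Lʳ` norms before a blow-up
time, `3 < r < ∞`** (Leray 1934, Acta Math. 63, §22, p. 227: "Si une solution devient irrégulière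
à l'époque `T`, on a `{∭ [uᵢuᵢ]^{p/2} δx}^{1/p} > A(1 - 3/p) ν^{(1+3/p)/2} (T - t)^{-(1-3/p)/2}`
(`p > 3`)"; Ożański–Pooley 2018, Cor. 6.25 via Lemma 6.23 (iii) and Cor. 6.24 (iii); Giga 1986,
Thm. 4 (4.8); Robinson–Rodrigo–Sadowski 2016, (11.18)), with the constant `c^{(r-3)/(2r)}`, `c`
the window constant of `leray_supnorm_le_of_Lp_holds`. Real proof, in the module docstring: if
`‖u(t₀)‖_r` were below the threshold, the `Lʳ` window from the restart time `t₀` would reach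
beyond `T`, so the sup-norm estimate applied to the translates `u(· + t₀)` (classical, Leray–Hopf
from `u(t₀)` by `IsLerayHopfOn.isLerayHopfOn_translate_of_bound`, bounded) bounds `u` pointwise on
`[(T + t₀)/2, T) × ℝ³`; together with the bound on the closed sub-strip `[0, (T + t₀)/2]`, `u` is
bounded on `[0, T) × ℝ³` and therefore continues classically past `T`
(`hasSmoothExtensionPast_of_bounded_holds`; Ożański–Pooley p. 143 "as otherwise we could extend
`u` beyond `T₀`"), contradicting maximality. [cite: Leray1934, §22 p. 227 with §21 (3.16)] [cite: OzanskiPooley2018, Cor. 6.25 with Cor. 6.24 (iii), Lemma 6.23 (iii), pp. 143–146] -/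
theorem leray_blowup_rate_holds : leray_blowup_rate := by
  intro r hr
  obtain ⟨K, hK, c, hc, hsup⟩ := leray_supnorm_le_of_Lp_holds r hr
  have hr0 : 0 < r := by linarith
  have hr3 : 0 < r - 3 := by linarith
  -- exponents
  set b : ℝ := (r - 3) / (2 * r) with hb
  set e : ℝ := 2 * r / (r - 3) with he
  have hbpos : 0 < b := by rw [hb]; positivity
  have hepos : 0 < e := by rw [he]; positivity
  have hbe : b * e = 1 := by rw [hb, he]; field_simp
  have hba : (r + 3) / (r - 3) * b = (r + 3) / (2 * r) := by rw [hb]; field_simp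
  refine ⟨c ^ b, Real.rpow_pos_of_pos hc _, ?_⟩
  intro ν T hν hT u p hmax hLH hbdd t₀ ht₀
  have hcl : IsClassicalNSSolutionOn (Ico 0 T) ν 0 u p := hmax.1
  have hTt : 0 < T - t₀ := sub_pos.2 ht₀.2
  by_contra hlt
  have hlt' := not_le.1 hlt
  -- ### the threshold as a power: `c^b ν^a (T - t₀)^{-b} = Q^b`, `Q = c ν^{(r+3)/(r-3)}/(T - t₀)`
  set Q : ℝ := c * ν ^ ((r + 3) / (r - 3)) / (T - t₀) with hQ
  have hQpos : 0 < Q := by rw [hQ]; positivity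
  have hthr : c ^ b * ν ^ ((r + 3) / (2 * r)) * (T - t₀) ^ (-((r - 3) / (2 * r))) = Q ^ b := by
    rw [hQ, Real.div_rpow (by positivity) hTt.le, Real.mul_rpow hc.le (by positivity),
      ← Real.rpow_mul hν.le, hba, show -((r - 3) / (2 * r)) = -b by rw [hb],
      Real.rpow_neg hTt.le]
    ring
  rw [hthr] at hlt'
  -- ### the datum `u t₀` in `Lʳ` and a real `N` with `‖u t₀‖_r ≤ N < Q^b`
  have hfin : eLpNorm (u t₀) (ENNReal.ofReal r) volume ≠ ∞ := (hlt'.trans ENNReal.ofReal_lt_top).ne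
  set V : ℝ := (eLpNorm (u t₀) (ENNReal.ofReal r) volume).toReal with hV
  have hV0 : 0 ≤ V := ENNReal.toReal_nonneg
  have hVR : V < Q ^ b := (ENNReal.lt_ofReal_iff_toReal_lt hfin).1 hlt'
  set N : ℝ := (V + Q ^ b) / 2 with hN
  have hQb : 0 < Q ^ b := Real.rpow_pos_of_pos hQpos _
  have hNpos : 0 < N := by rw [hN]; linarith
  have hVN : V ≤ N := by rw [hN]; linarith
  have hNR : N < Q ^ b := by rw [hN]; linarith
  have hNb : eLpNorm (u t₀) (ENNReal.ofReal r) volume ≤ ENNReal.ofReal N := by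
    rw [← ENNReal.ofReal_toReal hfin]
    exact ENNReal.ofReal_le_ofReal hVN
  -- ### the `Lʳ` window `τ = c ν^{(r+3)/(r-3)} N^{-e}` from `t₀` exceeds `T - t₀`
  set τ : ℝ := c * ν ^ ((r + 3) / (r - 3)) * N ^ (-(2 * r / (r - 3))) with hτ
  have hNe : N ^ e < Q := by
    have h1 : N ^ e < (Q ^ b) ^ e := Real.rpow_lt_rpow hNpos.le hNR hepos
    rwa [← Real.rpow_mul hQpos.le, hbe, Real.rpow_one] at h1
  have hτT : T - t₀ < τ := by
    have hNe0 : 0 < N ^ e := Real.rpow_pos_of_pos hNpos _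
    rw [hQ, lt_div_iff₀ hTt] at hNe
    rw [hτ, show -(2 * r / (r - 3)) = -e by rw [he], Real.rpow_neg hNpos.le,
      ← div_eq_mul_inv, lt_div_iff₀ hNe0]
    linarith
  -- ### the uniform pointwise bound `B` on the late strip `[(T + t₀)/2, T) × ℝ³`
  have hcont : ContinuousOn (uncurry u) (Ico 0 T ×ˢ univ) := hcl.smooth_velocity.continuousOn
  set B : ℝ := K * N * (ν * ((T - t₀) / 2)) ^ (-(3 / (2 * r))) with hB
  have hB0 : 0 ≤ B := by rw [hB]; positivity
  have hlate : ∀ s, (T + t₀) / 2 ≤ s → s < T → ∀ x, ‖u s x‖ ≤ B := by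
    intro s hst₀ hsT x
    have hst₀' : t₀ < s := by linarith
    -- the translate of `u` by `t₀` on `[0, t']`, `t' = (s - t₀ + (T - t₀))/2`
    set t' : ℝ := (s - t₀ + (T - t₀)) / 2 with ht'
    have ht'pos : 0 < t' := by rw [ht']; linarith
    have ht'lt : t' < T - t₀ := by rw [ht']; linarith
    have hst' : s - t₀ < t' := by rw [ht']; linarith
    -- a closed sub-strip `[0, T'']` containing `[t₀, t₀ + t']`
    set T'' : ℝ := (t' + t₀ + T) / 2 with hT''
    have hT''lt : T'' < T := by rw [hT'']; linarith
    have hT''gt : t' + t₀ < T'' := by rw [hT'']; linarith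
    have hT''pos : 0 < T'' := by linarith [ht₀.1]
    obtain ⟨M', hM'⟩ := exists_bound_Icc_of_eLpNorm_top ⟨hT''pos, hT''lt⟩ hcont hbdd
    have hM't : ∀ σ ∈ Icc 0 t', ∀ y, ‖u (σ + t₀) y‖ ≤ M' := fun σ hσ y =>
      hM' (σ + t₀) ⟨by linarith [hσ.1, ht₀.1], by linarith [hσ.2]⟩ y
    have hLHt : IsLerayHopfOn t' ν 0 (u t₀) (fun σ => u (σ + t₀)) := by
      have hLH'' : IsLerayHopfOn T'' ν 0 (u 0) u := IsLerayHopfOn.mono_holds hLH hT''lt.le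
      have hcl'' : IsClassicalNSSolutionOn (Ico 0 T'') ν 0 u p :=
        hcl.mono (Ico_subset_Ico_right hT''lt.le) (uniqueDiffOn_Ico 0 T'')
      rcases ht₀.1.eq_or_lt with h0 | ht₀pos
      · -- `t₀ = 0`: no translation
        subst h0
        have h1 : IsLerayHopfOn t' ν 0 (u 0) u := IsLerayHopfOn.mono_holds hLH (by linarith)
        simpa only [add_zero] using h1
      · have h1 := IsLerayHopfOn.isLerayHopfOn_translate_of_bound hν hT''pos hLH''
          (hLH.memLp 0 ⟨le_rfl, hT.le⟩) hcl'' hM' ⟨ht₀pos, by linarith⟩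
        exact IsLerayHopfOn.mono_holds h1 (by linarith)
    have hclt : IsClassicalNSSolutionOn (Ico 0 t') ν 0 (fun σ => u (σ + t₀))
        (fun σ => p (σ + t₀)) :=
      (hcl.translate_Ico_zero ht₀.1).mono (Ico_subset_Ico_right ht'lt.le) (uniqueDiffOn_Ico 0 t')
    have hbddt : ∀ T' ∈ Ioo 0 t', eLpNorm (uncurry fun σ => u (σ + t₀)) ∞
        (volume.restrict (Icc 0 T' ×ˢ univ)) < ∞ := fun T' hT' =>
      eLpNorm_uncurry_restrict_lt_top_of_bound hM't hT'.2.le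
    -- the sup-norm estimate at the time `s - t₀` of the translate
    have hLHt' : IsLerayHopfOn t' ν 0 ((fun σ => u (σ + t₀)) 0) (fun σ => u (σ + t₀)) := by
      simpa only [zero_add] using hLHt
    have hNb' : eLpNorm ((fun σ => u (σ + t₀)) 0) (ENNReal.ofReal r) volume ≤
        ENNReal.ofReal N := by
      simpa only [zero_add] using hNb
    have hle : s - t₀ ≤ c * ν ^ ((r + 3) / (r - 3)) * N ^ (-(2 * r / (r - 3))) := by
      rw [← hτ]; linarith
    have hbound := hsup ν t' hν ht'pos (fun σ => u (σ + t₀)) (fun σ => p (σ + t₀)) hclt hLHt'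
      hbddt N hNpos hNb' (s - t₀) ⟨by linarith, hst'⟩ hle
    simp only [sub_add_cancel] at hbound
    -- `K N (ν (s - t₀))^{-3/(2r)} ≤ B`, and the bound holds pointwise by continuity of `u s`
    have hmono : K * N * (ν * (s - t₀)) ^ (-(3 / (2 * r))) ≤ B := by
      rw [hB]
      refine mul_le_mul_of_nonneg_left ?_ (by positivity)
      exact Real.rpow_le_rpow_of_nonpos (by positivity)
        (mul_le_mul_of_nonneg_left (by linarith) hν.le) (by
          rw [neg_nonpos]; positivity)
    have hcu : Continuous (u s) := (hcl.contDiff_velocity ⟨by linarith [ht₀.1], hsT⟩).continuous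
    exact forall_norm_le_of_eLpNorm_top_le hcu hB0 (hbound.trans (ENNReal.ofReal_le_ofReal hmono)) x
  -- ### the pointwise bound on the early closed sub-strip `[0, (T + t₀)/2] × ℝ³`
  have hmid : (T + t₀) / 2 ∈ Ioo 0 T := ⟨by linarith [ht₀.1], by linarith [ht₀.2]⟩
  obtain ⟨M₀, hM₀⟩ := exists_bound_Icc_of_eLpNorm_top hmid hcont hbdd
  -- ### `u` is bounded on `[0, T) × ℝ³`, hence continues classically past `T`: contradiction
  have hbd : ∃ M : ℝ, ∀ t ∈ Ico 0 T, ∀ x, ‖u t x‖ ≤ M := by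
    refine ⟨max M₀ B, fun t ht x => ?_⟩
    rcases le_or_gt t ((T + t₀) / 2) with h | h
    · exact (hM₀ t ⟨ht.1, h⟩ x).trans (le_max_left _ _)
    · exact (hlate t h.le ht.2 x).trans (le_max_right _ _)
  exact hmax.2 (hasSmoothExtensionPast_of_bounded_holds hν hT hcl hLH hbd)

end Literature.Analysis.FluidPDE

end
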